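import Summits.BirchSwinnertonDyer.BirchSwinnertonDyer.Theorems.ManinLocalTwoThreeBlindNoDoubling
import Summits.BirchSwinnertonDyer.BirchSwinnertonDyer.Theorems.ManinLocalTwoThreeShimuraLedgerIrreducible
import Literature.NumberTheory.EllipticCurves.PeriodLatticeGamma1QuotientProofs
import Literature.NumberTheory.EllipticCurves.ModularSymbolsLattice
import Literature.NumberTheory.EllipticCurves.WeierstrassAdditionProofs
import Literature.NumberTheory.EllipticCurves.RealLatticePeriodDiscrProofs
import Literature.NumberTheory.EllipticCurves.Gamma1ParametrizationCuspRationality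
import HarnessLib

/-!
# The Shimura quotient `Λ₀(f)/Λ₁(f)` lands in the RATIONAL torsion of Stevens' curve; E-an-67 / E-an-66 in full
# modulo one printed rationality fact

Summit `BirchSwinnertonDyer`, route `ManinLocalTwoThree` (cell bsd-f2-manin), crux C2 `ManinOddAtFour`
(stmt-BirchSwinnertonDyer-22967); prover seat bsd-line-manin23-p1 (C2/C3 LEAD), gen 10.  Sequel to
`…ShimuraLedgerIrreducible.lean` (E-an-67 ⟸ ONE residual: «doubling `|c₀| = 2|c₁|` forces a NON-blind rational
`2`-torsion point») and `…BlindNoDoubling.lean` (blind ∧ doubled ⟹ index `4`, i.e. `Λ₁(f) = 2Λ₀(f)`).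

THE INPUT.  Instead of the «`Σ(N)` is of `μ`-type» dictionary (Ling–Oesterlé 1991 / Vatsal 2005, not in the tree) we
use ONE printed rationality statement, the tree's named fact `optimalGamma1Parametrization_cusp_rational` (F★,
`Literature/…/Gamma1ParametrizationCuspRationality.lean`, statement-only): the optimal
`X₁(N)`-parametrisation `φ₁ : X_μ(N) → E₁`, `τ ↦ u₁(c₁ · 2πi∫_{i∞}^τ f)`, is a morphism over `ℚ` (indeed over `ℤ`,
Conrad–Edixhoven–Stein 2003, §6.1.2, proof of Lemma 6.1.6: `X_μ(N)` is `ℤ`-smooth, `∞ ∈ X_μ(N)(ℤ)`, `X_μ(N) → J₁(N) → A`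
extends the morphism sending `∞` to `0`, and the analytic `q` at `∞` computes the standard `q`-expansion), and the cusps
of `X_μ(N)` lying over `∞ ∈ X₀(N)(ℚ)` — the `γ∞`, `γ ∈ Γ₀(N)` — are exactly its `ℚ`-rational cusps (ibid. §6.2,
p. 386); so `φ₁(γ∞) = u₁(c₁ · {∞, γ∞}_f) ∈ E₁(ℚ)`.

PROVED FROM IT (all other inputs are tree theorems):
* §1 `exists_point_eq_uniformize_of_mem_periodLattice`, `exists_ratCast_eq_weierstrassP_of_mem_periodLattice` — for an
  optimal `X₁(N)`-datum `D₁` of `W₁`, every `u₁(c₁ w)`, `w ∈ Λ₀(f)` (every period IS a cusp symbol,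
  `coe_periodLattice_eq_range`), is a RATIONAL point of `W₁`; off the lattice its `℘`-value is rational.
* §2 `exists_point_addOrderOf_eq_of_not_shimuraIndexPrimeTo` — **the Shimura quotient embeds in `W₁(ℚ)_tors`**:
  `p ∣ [Λ₀(f) : Λ₁(f)]` forces a rational point of order `p` ON STEVENS' CURVE `W₁` (compare Katz's «on some
  `p`-isogenous curve», `…ShimuraIndexKatz.lean`); with `IsIsogenous`-free hypotheses.
* §3 `exists_two_roots_of_index_four` — in E-an-68's index-`4` configuration `Λ₁(f) = 2Λ₀(f)` (so `Λ_{E₀} = Λ_{E₁}`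
  and `c₀ = ±2c₁`, `…GammaOneIndexFour.lean`) the half-periods of `Λ_{E₀}` are `c₁`-multiples of `Γ₀(N)`-periods,
  hence have RATIONAL `℘`-values: the `2`-division cubic of `W₀ : y² = x³ + a₂x² + a₄x + a₆` has two distinct rational
  roots.
* §4 **E-an-67 `ShimuraLedgerAtFour` and E-an-66 `TotallyBlindGammaOneTransfer` HOLD modulo F★**
  (`shimuraLedgerAtFour_of_cusp_rational`, `totallyBlindGammaOneTransfer_of_cusp_rational`): doubled ∧ all-blind ⟹
  index `4` (`index_four_of_allBlind_of_natAbs_eq_two_mul`) ⟹ two distinct rational roots, both blind — against E-an-71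
  (`not_kummerBlindAtTwo_of_kummerBlindAtTwo_of_ne`).

HONEST FRAMING: conditional on the named fact F★ (statement-only, printed); no Manin constant's parity is decided; the
C2 stubs are not narrowed; C2, Manin's conjecture and BSD are NOT proved by this file.  No sorry.
-/

set_option autoImplicit false
set_option linter.dupNamespace false

noncomputable section

open scoped Classical MatrixGroups ModularForm

open CongruenceSubgroup Complex WeierstrassCurve Literature.NumberTheory.EllipticCurves
  Literature.NumberTheory.EllipticCurves.ModularForms
open Summit.BirchSwinnertonDyer.Rank1Residual.ManinAdditive.ShimuraLedger
  Summit.BirchSwinnertonDyer.Rank1Residual.ManinAdditive.CuspidalKummer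
  Summit.BirchSwinnertonDyer.Rank1Residual.ManinAdditive.KatoCurve

namespace Summit.BirchSwinnertonDyer.BirchSwinnertonDyer.Theorems.ManinLocalTwoThree

/-! ### §0. The printed input (tree named fact `optimalGamma1Parametrization_cusp_rational`,
`Literature/NumberTheory/EllipticCurves/Gamma1ParametrizationCuspRationality.lean`): for an OPTIMAL `X₁(N)`-datum `D` of `W`
and `γ ∈ Γ₀(N)`, `D.uniformize (c · {∞, γ∞}_f)` is the base change of a point of `W(ℚ)` (Conrad–Edixhoven–Stein 2003
§6.1.2 / §6.2).  Below it is the hypothesis `hF`. -/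

/-! ### §1. Periods give rational points of Stevens' curve -/

section Stevens

variable {W : WeierstrassCurve ℚ} {N : ℕ} [NeZero N]

/-- The kernel of the uniformisation of an `X₁(N)`-datum is its Néron lattice (membership form). [folklore] -/
theorem gamma1_uniformize_eq_zero_iff (D : Gamma1ParametrizationData W N) (z : ℂ) :
    D.uniformize z = 0 ↔ z ∈ D.L.lattice := by
  rw [← SetLike.mem_coe, ← D.ker_uniformize, SetLike.mem_coe, AddMonoidHom.mem_ker]

variable [W.IsElliptic]

/-- **Every `Γ₀(N)`-period gives a rational point of Stevens' curve**: for an optimal `X₁(N)`-datum `D` of `W` and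
`w ∈ Λ₀(f)` (which IS a cusp symbol `{∞, γ∞}_f`, `coe_periodLattice_eq_range`), `D.uniformize (c w)` is the base change
of a point of `W(ℚ)`. [cite: ConradEdixhovenStein2003, §6.1.2 and §6.2] -/
theorem exists_point_eq_uniformize_of_mem_periodLattice (hF : optimalGamma1Parametrization_cusp_rational)
    (D : Gamma1ParametrizationData W N) (hD : D.IsOptimal) {w : ℂ} (hw : w ∈ periodLattice D.f) :
    ∃ P : (W.baseChange ℚ).toAffine.Point,
      Affine.Point.baseChange (W' := W) ℚ ℂ P = D.uniformize ((D.c : ℂ) * w) := by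
  have hw' : w ∈ (periodLattice D.f : Set ℂ) := hw
  rw [coe_periodLattice_eq_range] at hw'
  obtain ⟨γ, rfl⟩ := hw'
  exact hF W D hD γ

/-- **Rational `℘`-values at the transported periods**: for an optimal `X₁(N)`-datum `D` of `W`, `w ∈ Λ₀(f)` with
`c w ∉ Λ_E`, the value `℘_{Λ_E}(c w)` is a rational number (the `x`-coordinate of the rational point
`D.uniformize (c w)` is `℘(c w) − b₂/12`). [cite: ConradEdixhovenStein2003, §6.1.2 and §6.2] -/
theorem exists_ratCast_eq_weierstrassP_of_mem_periodLattice (hF : optimalGamma1Parametrization_cusp_rational)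
    (D : Gamma1ParametrizationData W N) (hD : D.IsOptimal) {w : ℂ} (hw : w ∈ periodLattice D.f)
    (hz : (D.c : ℂ) * w ∉ D.L.lattice) : ∃ x : ℚ, (x : ℂ) = D.L.weierstrassP ((D.c : ℂ) * w) := by
  obtain ⟨P, hP⟩ := exists_point_eq_uniformize_of_mem_periodLattice hF D hD hw
  obtain ⟨h, hspec⟩ := D.uniformize_spec _ hz
  have hb₂ : (W.baseChange ℂ).b₂ = (W.b₂ : ℂ) := by
    simp [WeierstrassCurve.baseChange, WeierstrassCurve.map_b₂]
  rcases P with _ | ⟨x, y, hxy⟩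
  · exfalso
    have h0 : D.uniformize ((D.c : ℂ) * w) = 0 := by rw [← hP]; rfl
    exact hz ((gamma1_uniformize_eq_zero_iff D _).mp h0)
  · refine ⟨x + W.b₂ / 12, ?_⟩
    rw [hspec, Affine.Point.baseChange, Affine.Point.map_some, Affine.Point.some.injEq] at hP
    have hx : (algebraMap ℚ ℂ x) = D.L.weierstrassP ((D.c : ℂ) * w) - (W.baseChange ℂ).b₂ / 12 := hP.1
    rw [hb₂] at hx
    have hx' : (x : ℂ) = D.L.weierstrassP ((D.c : ℂ) * w) - (W.b₂ : ℂ) / 12 := hx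
    push_cast
    rw [hx']
    ring

end Stevens

/-! ### §2. The Shimura quotient embeds in the rational torsion of Stevens' curve -/

section Embedding

variable {W : WeierstrassCurve ℚ} [W.IsElliptic] {N : ℕ} [NeZero N]

omit [W.IsElliptic] in
/-- **Periods give rational TORSION points**: for an optimal `X₁(N)`-datum `D` of `W` and `w ∈ Λ₀(f)`, the rational
point `D.uniformize (c w)` is killed by `φ(N)` (`φ(N) Λ₀(f) ⊆ Λ₁(f)`, `totient_mul_mem_periodLatticeGamma1`, and
`c Λ₁(f) ⊆ Λ_E`). [cite: LingOesterle1991, §1 and Thm. 1] -/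
theorem totient_nsmul_uniformize_eq_zero (D : Gamma1ParametrizationData W N) {w : ℂ} (hw : w ∈ periodLattice D.f) :
    Nat.totient N • D.uniformize ((D.c : ℂ) * w) = 0 := by
  rw [← map_nsmul, nsmul_eq_mul, gamma1_uniformize_eq_zero_iff]
  have h := D.smul_periodLatticeGamma1_le _ (totient_mul_mem_periodLatticeGamma1 D.f hw)
  convert h using 1
  ring

/-- **The Shimura quotient `Λ₀(f)/Λ₁(f)` embeds in `W₁(ℚ)_tors`, prime by prime**: for an OPTIMAL `X₁(N)`-datum `D`
of `W` (Stevens' curve of its class) and a prime `p` dividing the Shimura index (`¬ ShimuraIndexPrimeTo p f`: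
some `x ∈ Λ₀(f) ∖ Λ₁(f)` with `p x ∈ Λ₁(f)`), the curve `W` ITSELF has a rational point of order `p`, namely
`D.uniformize (c x)`.  (Katz's theorem gives such a point only on SOME `p`-isogenous curve,
`exists_isogeny_addOrderOf_eq_of_not_shimuraIndexPrimeTo`.)  Conditional on F★.
[cite: ConradEdixhovenStein2003, §6.1.2 and §6.2] [cite: Stevens1989, §2] -/
theorem exists_point_addOrderOf_eq_of_not_shimuraIndexPrimeTo (hF : optimalGamma1Parametrization_cusp_rational)
    (D : Gamma1ParametrizationData W N) (hD : D.IsOptimal) {p : ℕ} (hp : p.Prime)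
    (hS : ¬ ShimuraIndexPrimeTo p D.f) : ∃ P : (W.baseChange ℚ).toAffine.Point, addOrderOf P = p := by
  simp only [ShimuraIndexPrimeTo, not_forall, exists_prop] at hS
  obtain ⟨x, hx, hpx, hx₁⟩ := hS
  obtain ⟨P, hP⟩ := exists_point_eq_uniformize_of_mem_periodLattice hF D hD hx
  have hc : (D.c : ℂ) ≠ 0 := by exact_mod_cast D.maninConstant_ne_zero
  have hP0 : P ≠ 0 := by
    rintro rfl
    have h0 : D.uniformize ((D.c : ℂ) * x) = 0 := by rw [← hP, map_zero]
    rw [gamma1_uniformize_eq_zero_iff] at h0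
    obtain ⟨w, hw, hcw⟩ := hD _ h0
    exact hx₁ ((mul_left_cancel₀ hc hcw) ▸ hw)
  have hpP : p • P = 0 := by
    apply Affine.Point.map_injective (W' := W) (f := Algebra.ofId ℚ ℂ)
    rw [map_nsmul, map_zero]
    change p • Affine.Point.baseChange (W' := W) ℚ ℂ P = 0
    rw [hP, ← map_nsmul, nsmul_eq_mul, gamma1_uniformize_eq_zero_iff, ← mul_assoc, mul_comm (p : ℂ), mul_assoc]
    exact D.smul_periodLatticeGamma1_le _ hpx
  refine ⟨P, ?_⟩
  have hdvd : addOrderOf P ∣ p := addOrderOf_dvd_of_nsmul_eq_zero hpP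
  rcases (Nat.dvd_prime hp).mp hdvd with h | h
  · exact absurd (AddMonoid.addOrderOf_eq_one_iff.mp h) hP0
  · exact h

/-- Same, in the vocabulary of the tree's cusp-lifting laws (`W.toAffine.Point`). [cite: ConradEdixhovenStein2003, §6.1.2 and §6.2] -/
theorem exists_rationalPoint_addOrderOf_eq_of_not_shimuraIndexPrimeTo (hF : optimalGamma1Parametrization_cusp_rational)
    (D : Gamma1ParametrizationData W N) (hD : D.IsOptimal) {p : ℕ} (hp : p.Prime)
    (hS : ¬ ShimuraIndexPrimeTo p D.f) : ∃ P : W.toAffine.Point, addOrderOf P = p := by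
  obtain ⟨P, hP⟩ := exists_point_addOrderOf_eq_of_not_shimuraIndexPrimeTo hF D hD hp hS
  exact ⟨P, hP⟩

/-- Contrapositive: **no rational `p`-torsion on Stevens' curve ⟹ `p ∤ [Λ₀(f) : Λ₁(f)]`** (F★-conditional; for
`p = 2, 3` compare E-an-128₂ / the dichotomy, which need no F★ but conclude less). [cite: Stevens1989, §2] -/
theorem shimuraIndexPrimeTo_of_forall_addOrderOf_ne (hF : optimalGamma1Parametrization_cusp_rational)
    (D : Gamma1ParametrizationData W N) (hD : D.IsOptimal) {p : ℕ} (hp : p.Prime)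
    (hno : ∀ P : (W.baseChange ℚ).toAffine.Point, addOrderOf P ≠ p) : ShimuraIndexPrimeTo p D.f := by
  by_contra hS
  obtain ⟨P, hP⟩ := exists_point_addOrderOf_eq_of_not_shimuraIndexPrimeTo hF D hD hp hS
  exact hno P hP

end Embedding

/-! ### §3. Index `4`: the half-periods of `Λ_{E₀}` have rational `℘`-values -/

section IndexFour

variable {W₁ W₀ : WeierstrassCurve ℚ} [W₁.IsElliptic] [W₁.IsGloballyMinimal] [W₀.IsElliptic]
  [W₀.IsGloballyMinimal] {N : ℕ} [NeZero N]

/-- **In the index-`4` configuration the two Néron lattices coincide**: for an optimal `X₁(N)`-datum `D₁` and a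
lattice-optimal `X₀(N)`-datum `D₀` (globally minimal models) with `Λ₁(f₁) = 2Λ₀(f₀)`, `Λ_{E₀} = Λ_{E₁}`
(`c₀ = ±2c₁`, `maninConstant₀_eq_mul_or_eq_neg_mul_of_periodLatticeGamma1_eq_mul`). -/
theorem lattice_eq_of_index_four (D₁ : Gamma1ParametrizationData W₁ N) (D₀ : ModularParametrizationData W₀ N)
    (h₁ : D₁.IsOptimal) (h₀ : ∀ z ∈ D₀.L.lattice, ∃ w ∈ periodLattice D₀.f, z = D₀.c * w)
    (hidx : ∀ z : ℂ, z ∈ periodLatticeGamma1 D₁.f ↔ ∃ w ∈ periodLattice D₀.f, z = 2 * w) :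
    D₀.L.lattice = D₁.L.lattice := by
  have hidx' : ∀ z : ℂ, z ∈ periodLatticeGamma1 D₁.f ↔ ∃ w ∈ periodLattice D₀.f, z = ((2 : ℤ) : ℂ) * w := by
    intro z
    rw [hidx z, Int.cast_ofNat]
  obtain ⟨ε, hε, hcc⟩ : ∃ ε : ℂ, (ε = 1 ∨ ε = -1) ∧ (D₀.c : ℂ) = ε * (2 * D₁.c) := by
    rcases maninConstant₀_eq_mul_or_eq_neg_mul_of_periodLatticeGamma1_eq_mul D₁ D₀ h₁ h₀ 2 hidx' with h | h
    · refine ⟨1, Or.inl rfl, ?_⟩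
      rw [one_mul]
      exact_mod_cast h
    · refine ⟨-1, Or.inr rfl, ?_⟩
      rw [neg_one_mul]
      exact_mod_cast h
  have hε2 : ε * ε = 1 := by rcases hε with rfl | rfl <;> norm_num
  have hεmem : ∀ (S : Submodule ℤ ℂ) (w : ℂ), w ∈ S → ε * w ∈ S := by
    intro S w hw
    rcases hε with rfl | rfl
    · rwa [one_mul]
    · rw [neg_one_mul]; exact neg_mem hw
  ext z
  constructor
  · intro hz
    obtain ⟨w, hw, rfl⟩ := h₀ z hz
    have h2w : (2 : ℂ) * w ∈ periodLatticeGamma1 D₁.f := (hidx _).mpr ⟨w, hw, rfl⟩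
    have hmem := D₁.smul_periodLatticeGamma1_le _ h2w
    have e : (D₀.c : ℂ) * w = ε * ((D₁.c : ℂ) * (2 * w)) := by rw [hcc]; ring
    rw [e]
    exact hεmem _ _ hmem
  · intro hz
    obtain ⟨w₁, hw₁, rfl⟩ := h₁ z hz
    obtain ⟨w, hw, hw₁w⟩ := (hidx w₁).mp hw₁
    have hmem := D₀.smul_periodLattice_le w hw
    have e : (D₁.c : ℂ) * w₁ = ε * ((D₀.c : ℂ) * w) := by
      rw [hw₁w, hcc]
      linear_combination (-(2 * (D₁.c : ℂ) * w)) * hε2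
    rw [e]
    exact hεmem _ _ hmem

/-- **Index `4` ⟹ the half-periods of `Λ_{E₀}` have RATIONAL `℘`-values** (F★-conditional): `2z ∈ Λ_{E₀} = Λ_{E₁} =
c₁Λ₁(f) = 2c₁Λ₀(f)` makes `z = c₁ w` with `w ∈ Λ₀(f)`, and §1 applies. -/
theorem exists_ratCast_eq_weierstrassP_halfPeriod_of_index_four (hF : optimalGamma1Parametrization_cusp_rational)
    (D₁ : Gamma1ParametrizationData W₁ N) (D₀ : ModularParametrizationData W₀ N) (h₁ : D₁.IsOptimal)
    (h₀ : ∀ z ∈ D₀.L.lattice, ∃ w ∈ periodLattice D₀.f, z = D₀.c * w) (hf : D₁.f = D₀.f)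
    (hidx : ∀ z : ℂ, z ∈ periodLatticeGamma1 D₁.f ↔ ∃ w ∈ periodLattice D₀.f, z = 2 * w)
    {z : ℂ} (hz : z ∉ D₀.L.lattice) (h2z : 2 * z ∈ D₀.L.lattice) :
    ∃ x : ℚ, (x : ℂ) = D₀.L.weierstrassP z := by
  have hΛ := lattice_eq_of_index_four D₁ D₀ h₁ h₀ hidx
  have h2z₁ : 2 * z ∈ D₁.L.lattice := hΛ ▸ h2z
  obtain ⟨w₁, hw₁, h2zw⟩ := h₁ _ h2z₁
  obtain ⟨w, hw, rfl⟩ := (hidx w₁).mp hw₁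
  have hzw : z = (D₁.c : ℂ) * w := by linear_combination h2zw / 2
  have hw' : w ∈ periodLattice D₁.f := hf ▸ hw
  have hz₁ : (D₁.c : ℂ) * w ∉ D₁.L.lattice := by rw [← hzw, ← hΛ]; exact hz
  obtain ⟨x, hx⟩ := exists_ratCast_eq_weierstrassP_of_mem_periodLattice hF D₁ h₁ hw' hz₁
  refine ⟨x, ?_⟩
  rw [hx, ← hzw, PeriodPair.weierstrassP_eq_of_lattice_eq hΛ]

/-- **Index `4` ⟹ the `2`-division cubic of `W₀ : y² = x³ + a₂x² + a₄x + a₆` has two distinct rational roots**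
(`e = ℘(ω₁/2) − a₂/3`, `e' = ℘(ω₂/2) − a₂/3`; distinct because `℘(u) = ℘(v)` forces `u ≡ ±v`).  This is the
«index `4` ⟹ full rational `2`-torsion» half of the `μ`-type dictionary, F★-conditional. -/
theorem exists_two_roots_of_index_four (hF : optimalGamma1Parametrization_cusp_rational)
    (D₁ : Gamma1ParametrizationData W₁ N) (D₀ : ModularParametrizationData W₀ N) (h₁ : D₁.IsOptimal)
    (h₀ : ∀ z ∈ D₀.L.lattice, ∃ w ∈ periodLattice D₀.f, z = D₀.c * w) (hf : D₁.f = D₀.f)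
    (hidx : ∀ z : ℂ, z ∈ periodLatticeGamma1 D₁.f ↔ ∃ w ∈ periodLattice D₀.f, z = 2 * w)
    (ha₁ : W₀.a₁ = 0) (ha₃ : W₀.a₃ = 0) :
    ∃ e e' : ℚ, e ≠ e' ∧ e ^ 3 + W₀.a₂ * e ^ 2 + W₀.a₄ * e + W₀.a₆ = 0 ∧
      e' ^ 3 + W₀.a₂ * e' ^ 2 + W₀.a₄ * e' + W₀.a₆ = 0 := by
  have hz₁ : D₀.L.ω₁ / 2 ∉ D₀.L.lattice := D₀.L.ω₁_div_two_notMem_lattice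
  have hz₂ : D₀.L.ω₂ / 2 ∉ D₀.L.lattice := D₀.L.ω₂_div_two_notMem_lattice
  have h2z₁ : 2 * (D₀.L.ω₁ / 2) ∈ D₀.L.lattice := by
    rw [mul_div_cancel₀ _ (two_ne_zero' ℂ)]; exact D₀.L.ω₁_mem_lattice
  have h2z₂ : 2 * (D₀.L.ω₂ / 2) ∈ D₀.L.lattice := by
    rw [mul_div_cancel₀ _ (two_ne_zero' ℂ)]; exact D₀.L.ω₂_mem_lattice
  obtain ⟨x₁, hx₁⟩ := exists_ratCast_eq_weierstrassP_halfPeriod_of_index_four hF D₁ D₀ h₁ h₀ hf hidx hz₁ h2z₁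
  obtain ⟨x₂, hx₂⟩ := exists_ratCast_eq_weierstrassP_halfPeriod_of_index_four hF D₁ D₀ h₁ h₀ hf hidx hz₂ h2z₂
  have root : ∀ {z : ℂ} {x : ℚ}, z ∉ D₀.L.lattice → 2 * z ∈ D₀.L.lattice → (x : ℂ) = D₀.L.weierstrassP z →
      (x - W₀.a₂ / 3) ^ 3 + W₀.a₂ * (x - W₀.a₂ / 3) ^ 2 + W₀.a₄ * (x - W₀.a₂ / 3) + W₀.a₆ = 0 := by
    intro z x hz h2z hx
    have hcubic : 4 * D₀.L.weierstrassP z ^ 3 - D₀.L.g₂ * D₀.L.weierstrassP z - D₀.L.g₃ = 0 := by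
      rw [← D₀.L.derivWeierstrassP_sq z hz, D₀.L.derivWeierstrassP_eq_zero_of_two_mul_mem h2z]
      ring
    have h := isRoot_cubic_of_weierstrassP_sub W₀ ha₁ ha₃ D₀.isNeronLattice hcubic
    rw [← hx] at h
    exact_mod_cast h
  refine ⟨x₁ - W₀.a₂ / 3, x₂ - W₀.a₂ / 3, ?_, root hz₁ h2z₁ hx₁, root hz₂ h2z₂ hx₂⟩
  intro heq
  have hx : x₁ = x₂ := sub_left_injective heq
  have h℘ : D₀.L.weierstrassP (D₀.L.ω₁ / 2) = D₀.L.weierstrassP (D₀.L.ω₂ / 2) := by rw [← hx₁, ← hx₂, hx]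
  rcases (D₀.L.weierstrassP_eq_weierstrassP_iff hz₁ hz₂).mp h℘ with h | h
  · have h' : ((1 / 2 : ℚ) : ℂ) * D₀.L.ω₁ + ((1 / 2 : ℚ) : ℂ) * D₀.L.ω₂ ∈ D₀.L.lattice := by
      convert h using 1
      push_cast
      ring
    exact absurd (PeriodPair.mul_ω₁_add_mul_ω₂_mem_lattice.mp h') (by norm_num)
  · have h' : ((1 / 2 : ℚ) : ℂ) * D₀.L.ω₁ + ((-(1 / 2) : ℚ) : ℂ) * D₀.L.ω₂ ∈ D₀.L.lattice := by
      convert h using 1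
      push_cast
      ring
    exact absurd (PeriodPair.mul_ω₁_add_mul_ω₂_mem_lattice.mp h') (by norm_num)

end IndexFour

/-! ### §4. E-an-67 `ShimuraLedgerAtFour` and E-an-66 `TotallyBlindGammaOneTransfer`, modulo F★ -/

section Ledger

variable {W₁ W₀ : WeierstrassCurve ℚ} [W₁.IsElliptic] [W₁.IsGloballyMinimal] [W₀.IsElliptic]
  [W₀.IsGloballyMinimal] {N : ℕ} [NeZero N]

/-- **The residual of E-an-67, DISCHARGED modulo F★**: for the optimal `X₁(N)`/`X₀(N)`-pair `(D₁, D₀)` of a class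
(`4 ∣ N`, globally minimal models, `W₀` with `a₁ = a₃ = 0`), doubling `|c₀| = 2|c₁|` forces a NON-blind rational
`2`-torsion point on `W₀`.  If all rational `2`-torsion were blind, the configuration would be index `4`
(`index_four_of_allBlind_of_natAbs_eq_two_mul`), §3 would give two distinct rational roots, both blind — against E-an-71
(`not_kummerBlindAtTwo_of_kummerBlindAtTwo_of_ne`). [cite: ConradEdixhovenStein2003, §6.1.2 and §6.2] -/
theorem hasNonBlindRationalTwoTorsion_of_natAbs_eq_two_mul (hF : optimalGamma1Parametrization_cusp_rational)
    (D₁ : Gamma1ParametrizationData W₁ N) (D₀ : ModularParametrizationData W₀ N) (hiso : IsIsogenous W₁ W₀)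
    (h₁ : D₁.IsOptimal) (h₀ : ∀ z ∈ D₀.L.lattice, ∃ w ∈ periodLattice D₀.f, z = D₀.c * w) (h4 : 2 ^ 2 ∣ N)
    (ha₁ : W₀.a₁ = 0) (ha₃ : W₀.a₃ = 0) (hdouble : D₀.maninConstant.natAbs = 2 * D₁.maninConstant.natAbs) :
    HasNonBlindRationalTwoTorsion W₀ := by
  rcases allBlind_or_hasNonBlind W₀ with hbl | h
  swap
  · exact h
  exfalso
  have hidx := index_four_of_allBlind_of_natAbs_eq_two_mul D₁ D₀ hiso h₁ h₀ h4 ha₁ ha₃ hbl hdouble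
  have hf : D₁.f = D₀.f := D₁.f_eq_of_isIsogenous D₀ hiso
  obtain ⟨e, e', hne, he, he'⟩ := exists_two_roots_of_index_four hF D₁ D₀ h₁ h₀ hf hidx ha₁ ha₃
  obtain ⟨A₂, A₄, E, hA₂, hA₄, hE, hb⟩ := hbl e he
  obtain ⟨A₂', A₄', E', hA₂', hA₄', hE', hb'⟩ := hbl e' he'
  have h22 : A₂ = A₂' := by exact_mod_cast hA₂.trans hA₂'.symm
  have h44 : A₄ = A₄' := by exact_mod_cast hA₄.trans hA₄'.symm
  subst h22 h44
  set A₆ : ℤ := -(E ^ 3 + A₂ * E ^ 2 + A₄ * E) with hA₆def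
  have heZ : E ^ 3 + A₂ * E ^ 2 + A₄ * E + A₆ = 0 := by rw [hA₆def]; ring
  have hA₆ : (A₆ : ℚ) = W₀.a₆ := by
    have h := he
    rw [← hE, ← hA₂, ← hA₄] at h
    rw [hA₆def]
    push_cast
    linear_combination -h
  have hEE' : E ≠ E' := by
    rintro rfl
    exact hne (hE.symm.trans hE')
  have he'Z : E' ^ 3 + A₂ * E' ^ 2 + A₄ * E' + A₆ = 0 := by
    have h := he'
    rw [← hE', ← hA₂, ← hA₄, ← hA₆] at h
    exact_mod_cast h
  exact not_kummerBlindAtTwo_of_kummerBlindAtTwo_of_ne W₀ ha₁ ha₃ A₂ A₄ A₆ E E' hA₂ hA₄ hA₆ hEE' heZ he'Z hb hb'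

end Ledger

/-- **E-an-67 `ShimuraLedgerAtFour` HOLDS modulo F★** (an MEMO-an §58, `…/ManinAdditive/ShimuraLedger.lean`, BY NAME): for the
optimal `X₁(N)`/`X₀(N)`-pair of a class at `4 ∣ N` (`a₁ = a₃ = 0` on `W₀`), `|c₀| = |c₁|`, or `|c₀| = 2|c₁|` AND `W₀` has a
NON-blind rational `2`-torsion point.  (`shimuraLedgerAtFour_of_residual` + `hasNonBlindRationalTwoTorsion_of_natAbs_eq_two_mul`.)
[cite: ConradEdixhovenStein2003, §6.1.2 and §6.2] [cite: CesnaviciusNeururerSaha2023, Lemma 6.5 (shape)] -/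
theorem shimuraLedgerAtFour_of_cusp_rational (hF : optimalGamma1Parametrization_cusp_rational) :
    ShimuraLedgerAtFour := by
  refine shimuraLedgerAtFour_of_residual ?_
  intro W₁ W₀ _ _ _ _ N _ D₁ D₀ hiso h₁ h₀ h4 ha₁ ha₃ hdouble _
  exact hasNonBlindRationalTwoTorsion_of_natAbs_eq_two_mul hF D₁ D₀ hiso h₁ h₀ h4 ha₁ ha₃ hdouble

/-- **E-an-66 `TotallyBlindGammaOneTransfer` HOLDS modulo F★** (BY NAME): at `4 ∣ N`, an `X₀(N)`-optimal `W₀` with `a₁ = a₃ = 0`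
all of whose rational `2`-torsion is blind has `|c₀| = |c₁|`. (`totallyBlindGammaOneTransfer_of_ledger`.)
[cite: ConradEdixhovenStein2003, §6.1.2 and §6.2] -/
theorem totallyBlindGammaOneTransfer_of_cusp_rational (hF : optimalGamma1Parametrization_cusp_rational) :
    TotallyBlindGammaOneTransfer :=
  totallyBlindGammaOneTransfer_of_ledger (shimuraLedgerAtFour_of_cusp_rational hF)


end Summit.BirchSwinnertonDyer.BirchSwinnertonDyer.Theorems.ManinLocalTwoThree

end
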